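import Summits.ResolutionOfSingularities.ResolutionOfSingularities.Theorems.FrobeniusLadderFRationalResolutionGaloisChartTransitive
import Summits.ResolutionOfSingularities.ResolutionOfSingularities.Theorems.FrobeniusLadderFRationalResolutionGaloisResiduePointEmbedding
import Summits.ResolutionOfSingularities.ResolutionOfSingularities.Theorems.FrobeniusLadderFRationalResolutionGaloisResidueAutomorphisms
import HarnessLib

/-!
# Crux `FrobeniusLadder.FRationalResolution` (stmt-ResolutionOfSingularities-15317), line `redirect`,
# stub `stub_diagonalizableQuotientResolution` — the TWISTED-POINT OBSTRUCTION of the Galois route, assembled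

Setting (`…GaloisTwistChart`): `K'/K` finite Galois, `B' = B ⊗_K K'` with twists `1 ⊗ σ`, chart `C' = B' ⊗_B C` with chart twists `σ''`,
`𝔔' ⊆ B'` maximal, `D` = decomposition group of `𝔔'`. The step ✓ `…GaloisFixedPointPiece` closes a point as soon as some trivial-residue
point `𝔚` over `𝔔'` is FIXED by all `σ''`, `σ ∈ D` (`hfix`). This file records, from ✓ `…GaloisChartTransitive` (transitivity),
✓ `…GaloisResiduePointEmbedding` (points ↔ embeddings, stabilizer criterion) and ✓ `…GaloisResidueAutomorphisms` (`D ↠ Aut_B κ(𝔔')`),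
exactly when that happens:

* `exists_decomposition_chartTwist_ne` — if there are TWO distinct points of the chart over `(𝔔, 𝔔')`, then NO point over `(𝔔, 𝔔')` is
  fixed by the decomposition group (it acts transitively): `hfix` fails at every one of them.
* `ne_of_belongs_of_ne` — points belonging to distinct embeddings `ι₁ ≠ ι₂ : κ(𝔔) → κ(𝔔')` are distinct (so `d ≥ 2` embeddings ⇒ `≥ 2` points).
* `exists_decomposition_chartTwist_ne_of_ringEquiv` — if some `B`-fixing ring automorphism `f` of `κ(𝔔')` MOVES `ι` (`f ∘ ι ≠ ι`), the point
  belonging to `ι` is moved by some `σ ∈ D`.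
* `map_chartTwist_eq_of_forall_ringHom` — conversely, if EVERY `B`-fixing ring endomorphism of `κ(𝔔')` fixes `ι`, then `hfix` holds at the point
  belonging to `ι` (e.g. `ι(κ(𝔔)) = image of κ(𝔭)`: the residue-trivial case).

So for an étale chart (separable `κ(𝔔)/κ(𝔭)`) and `K'` containing a normal closure, `hfix` ⟺ `κ(𝔔) = κ(𝔭)`; at a twisted point (`d ≥ 2`) no
unsymmetrized piece is decomposition-stable by a choice of point (memo MEMO-15317-leafhand2-g15 §2).

Honest label: plumbing/structure toward ONE leaf stub (no stub, crux or summit closed). No definitions, no named facts, no sorry.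
[cite: StacksProject, Tag 09EB; Tag 0BRI; Tag 00UW]
-/

noncomputable section

-- single-problem summit: the doubled namespace component is forced
set_option linter.dupNamespace false

open scoped TensorProduct

namespace Summit.ResolutionOfSingularities.ResolutionOfSingularities.Theorems.FRationalResolution.GaloisTwistedPointObstruction

variable {K B K' C : Type} [Field K] [CommRing B] [Algebra K B] [Field K'] [Algebra K K'] [CommRing C] [Algebra B C]

/-- **Two points ⇒ no fixed point.** If `𝔚₁ ≠ 𝔚₂` are primes of the chart over the same `𝔔' ⊆ B ⊗_K K'` and the same prime of `C`,
then some `σ` in the decomposition group of `𝔔'` moves `𝔚₁` (namely onto `𝔚₂`). [cite: StacksProject, Tag 09EB] -/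
theorem exists_decomposition_chartTwist_ne [FiniteDimensional K K'] [IsGalois K K'] (𝔔' : Ideal (B ⊗[K] K'))
    (𝔚₁ 𝔚₂ : Ideal ((B ⊗[K] K') ⊗[B] C)) [𝔚₁.IsPrime] [𝔚₂.IsPrime] (hne : 𝔚₁ ≠ 𝔚₂)
    (h₁ : 𝔚₁.comap (algebraMap (B ⊗[K] K') ((B ⊗[K] K') ⊗[B] C)) = 𝔔')
    (h₂ : 𝔚₂.comap (algebraMap (B ⊗[K] K') ((B ⊗[K] K') ⊗[B] C)) = 𝔔')
    (h : 𝔚₁.comap ((Algebra.TensorProduct.includeRight : C →ₐ[B] (B ⊗[K] K') ⊗[B] C) : C →+* (B ⊗[K] K') ⊗[B] C) =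
      𝔚₂.comap ((Algebra.TensorProduct.includeRight : C →ₐ[B] (B ⊗[K] K') ⊗[B] C) : C →+* (B ⊗[K] K') ⊗[B] C)) :
    ∃ σ : K' ≃ₐ[K] K',
      𝔔'.map (Algebra.TensorProduct.map (AlgHom.id B B) (σ : K' →ₐ[K] K')) = 𝔔' ∧
      𝔚₁.map (Algebra.TensorProduct.map (Algebra.TensorProduct.map (AlgHom.id B B) (σ : K' →ₐ[K] K'))
        (AlgHom.id B C)) ≠ 𝔚₁ := by
  obtain ⟨σ, hσD, hσ⟩ := GaloisChartTransitive.exists_decomposition_map_chartTwist_eq 𝔔' 𝔚₁ 𝔚₂ h₁ h₂ h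
  exact ⟨σ, hσD, fun heq => hne (heq.symm.trans hσ.symm)⟩

/-- **Distinct embeddings ⇒ distinct points.** Points of `B' ⊗_B C` contracting into `𝔔'` and belonging to DISTINCT ring maps
`ι₁ ≠ ι₂ : C/𝔔 → B'/𝔔'` are distinct. [cite: StacksProject, Tag 00UW] -/
theorem ne_of_belongs_of_ne {B' : Type} [CommRing B'] [Algebra B B'] (𝔔 : Ideal C) (𝔔' : Ideal B')
    (ι₁ ι₂ : C ⧸ 𝔔 →+* B' ⧸ 𝔔') (hι : ι₁ ≠ ι₂) (𝔚₁ 𝔚₂ : Ideal (B' ⊗[B] C))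
    (h𝔚₁ : 𝔚₁.comap (algebraMap B' (B' ⊗[B] C)) ≤ 𝔔')
    (h₁ : ∀ (c : C) (b' : B'), Ideal.Quotient.mk 𝔔' b' = ι₁ (Ideal.Quotient.mk 𝔔 c) →
      (Algebra.TensorProduct.includeRight : C →ₐ[B] B' ⊗[B] C) c - algebraMap B' (B' ⊗[B] C) b' ∈ 𝔚₁)
    (h₂ : ∀ (c : C) (b' : B'), Ideal.Quotient.mk 𝔔' b' = ι₂ (Ideal.Quotient.mk 𝔔 c) →
      (Algebra.TensorProduct.includeRight : C →ₐ[B] B' ⊗[B] C) c - algebraMap B' (B' ⊗[B] C) b' ∈ 𝔚₂) :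
    𝔚₁ ≠ 𝔚₂ := by
  intro heq
  subst heq
  exact hι (GaloisResiduePointEmbedding.ringHom_eq_of_belongs 𝔔 𝔔' ι₁ ι₂ 𝔚₁ h𝔚₁ h₁ h₂)

/-- **A residue automorphism moving `ι` yields a chart twist moving the point.** `K'/K` finite Galois, `𝔔' ⊆ B ⊗_K K'` maximal,
`𝔚` over `𝔔'` belonging to `ι : C/𝔔 → B'/𝔔'`, and `f` a ring automorphism of `B'/𝔔'` fixing the classes of `b ⊗ 1` with `f ∘ ι ≠ ι`.
Then some `σ` in the decomposition group of `𝔔'` has `σ''(𝔚) ≠ 𝔚`. [cite: StacksProject, Tag 0BRI; Tag 09EB; Tag 00UW] -/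
theorem exists_decomposition_chartTwist_ne_of_ringEquiv [FiniteDimensional K K'] [IsGalois K K'] (𝔔 : Ideal C)
    (𝔔' : Ideal (B ⊗[K] K')) [𝔔'.IsMaximal] (ι : C ⧸ 𝔔 →+* (B ⊗[K] K') ⧸ 𝔔')
    (𝔚 : Ideal ((B ⊗[K] K') ⊗[B] C))
    (h𝔚B : 𝔚.comap (algebraMap (B ⊗[K] K') ((B ⊗[K] K') ⊗[B] C)) = 𝔔')
    (hι : ∀ (c : C) (b' : B ⊗[K] K'), Ideal.Quotient.mk 𝔔' b' = ι (Ideal.Quotient.mk 𝔔 c) →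
      (Algebra.TensorProduct.includeRight : C →ₐ[B] (B ⊗[K] K') ⊗[B] C) c -
        algebraMap (B ⊗[K] K') ((B ⊗[K] K') ⊗[B] C) b' ∈ 𝔚)
    (f : (B ⊗[K] K') ⧸ 𝔔' ≃+* (B ⊗[K] K') ⧸ 𝔔')
    (hf : ∀ b : B, f (Ideal.Quotient.mk 𝔔' (algebraMap B (B ⊗[K] K') b)) =
      Ideal.Quotient.mk 𝔔' (algebraMap B (B ⊗[K] K') b))
    (hmove : (f : (B ⊗[K] K') ⧸ 𝔔' →+* (B ⊗[K] K') ⧸ 𝔔').comp ι ≠ ι) :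
    ∃ σ : K' ≃ₐ[K] K',
      𝔔'.map (Algebra.TensorProduct.map (AlgHom.id B B) (σ : K' →ₐ[K] K')) = 𝔔' ∧
      𝔚.map (Algebra.TensorProduct.map (Algebra.TensorProduct.map (AlgHom.id B B) (σ : K' →ₐ[K] K'))
        (AlgHom.id B C)) ≠ 𝔚 := by
  obtain ⟨σ, hσ, hfσ⟩ := GaloisResidueAutomorphisms.exists_twist_of_residue_ringEquiv 𝔔' f hf
  refine ⟨σ, hσ, fun hfix => hmove ?_⟩
  -- `σ̄ = f` as ring maps, and the stabilizer criterion gives `σ̄ ∘ ι = ι`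
  have hbar : (Ideal.quotientMap 𝔔'
      (Algebra.TensorProduct.map (AlgHom.id B B) (σ : K' →ₐ[K] K') : B ⊗[K] K' →+* B ⊗[K] K')
      (GaloisResiduePointEmbedding.le_comap_twist_of_map_eq 𝔔' σ hσ)) =
      (f : (B ⊗[K] K') ⧸ 𝔔' →+* (B ⊗[K] K') ⧸ 𝔔') := by
    refine RingHom.ext fun y => ?_
    obtain ⟨x, rfl⟩ := Ideal.Quotient.mk_surjective y
    rw [Ideal.quotientMap_mk]
    simp only [RingHom.coe_coe]
    rw [hfσ x]
  have hcrit := (GaloisResiduePointEmbedding.map_chartTwist_eq_iff 𝔔 𝔔' ι 𝔚 h𝔚B hι σ hσ).mp hfix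
  rwa [hbar] at hcrit

/-- **All `B`-fixing residue endomorphisms fix `ι` ⇒ `hfix`.** `𝔔' ⊆ B ⊗_K K'` maximal, `𝔚` over `𝔔'` belonging to `ι`. If every ring
endomorphism of `B'/𝔔'` fixing the classes of `b ⊗ 1` fixes `ι`, then every chart twist of the decomposition group fixes `𝔚` (the
hypothesis `hfix` of `…GaloisFixedPointPiece`; e.g. when `ι` takes values in the image of `B`). [cite: StacksProject, Tag 09EB; Tag 00UW] -/
theorem map_chartTwist_eq_of_forall_ringHom (𝔔 : Ideal C) (𝔔' : Ideal (B ⊗[K] K')) [𝔔'.IsMaximal]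
    (ι : C ⧸ 𝔔 →+* (B ⊗[K] K') ⧸ 𝔔') (𝔚 : Ideal ((B ⊗[K] K') ⊗[B] C))
    (h𝔚B : 𝔚.comap (algebraMap (B ⊗[K] K') ((B ⊗[K] K') ⊗[B] C)) = 𝔔')
    (hι : ∀ (c : C) (b' : B ⊗[K] K'), Ideal.Quotient.mk 𝔔' b' = ι (Ideal.Quotient.mk 𝔔 c) →
      (Algebra.TensorProduct.includeRight : C →ₐ[B] (B ⊗[K] K') ⊗[B] C) c -
        algebraMap (B ⊗[K] K') ((B ⊗[K] K') ⊗[B] C) b' ∈ 𝔚)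
    (hall : ∀ f : (B ⊗[K] K') ⧸ 𝔔' →+* (B ⊗[K] K') ⧸ 𝔔',
      (∀ b : B, f (Ideal.Quotient.mk 𝔔' (algebraMap B (B ⊗[K] K') b)) =
        Ideal.Quotient.mk 𝔔' (algebraMap B (B ⊗[K] K') b)) → f.comp ι = ι)
    (σ : K' ≃ₐ[K] K') (hσ : 𝔔'.map (Algebra.TensorProduct.map (AlgHom.id B B) (σ : K' →ₐ[K] K')) = 𝔔') :
    𝔚.map (Algebra.TensorProduct.map (Algebra.TensorProduct.map (AlgHom.id B B) (σ : K' →ₐ[K] K'))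
      (AlgHom.id B C)) = 𝔚 := by
  refine (GaloisResiduePointEmbedding.map_chartTwist_eq_iff 𝔔 𝔔' ι 𝔚 h𝔚B hι σ hσ).mpr (hall _ fun b => ?_)
  rw [Ideal.quotientMap_mk, RingHom.coe_coe, Algebra.TensorProduct.algebraMap_apply, Algebra.algebraMap_self,
    RingHom.id_apply, Algebra.TensorProduct.map_tmul, AlgHom.id_apply, map_one]

end Summit.ResolutionOfSingularities.ResolutionOfSingularities.Theorems.FRationalResolution.GaloisTwistedPointObstruction

end
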